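import Summits.CriticalPhenomena.PercolationContinuityZ3.Theorems.PercNearOneGluingNoHeavyConstsMDLXJointMarkerClusterLemmas
import Literature.Probability.Percolation.TwoClusterGibbsCovariance
import Literature.Probability.Percolation.ConditionalPositiveAssociationProofs
import HarnessLib

/-!
# The marker-cluster decomposition: WITHIN each marker class the owner's cluster is positively correlated with `{s↔z}`
# (PAPER-2 track (ii); seat `prim-consts-2`, gen 17 — blueprint step (2) of memo FROM-prim-consts-2-g17-CYLINDER-DUALITY.md §8)

builds on p205010 (kernel theorem, internal audit signed; external expert review pending).  Support file (`--supports
stmt-CriticalPhenomena-4575`).  No definitions, no named facts, no sorries; standard axioms.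

Setting (file `…MarkerClusterLemmas.lean`): owner `s`, avoided set `X`, markers `y ≠ s`, `z`; `D = {s↮X}`; the marker cluster off the owner
`L(ω) = {v | y ↔ v in ω ∖ st(s)}`; for a vertex set `L₀` and a truth value `a` the MARKER CLASS
`cls(L₀,a) = {ω | L(ω) = L₀ ∧ ((∃ u ∈ L₀, s(s,u) ∈ ω) ↔ a)}` (the marker cluster and the marker coin `1{s↔y}`).

* `Consts.markerClass_condCov_nonneg` — **THEOREM (the within part of the marker-cluster reduction is nonnegative): for every monotone `F`, every
  `L₀`, `a`:  `(∫_{D∩cls} F(C_s)) · μ(D ∩ cls ∩ {s↔z}) ≤ μ(D ∩ cls) · ∫_{D∩cls∩{s↔z}} F(C_s)`,** i.e. `Cov_ν(F(C_s), 1{s↔z} | cls) ≥ 0` for every class of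
  positive mass.  PROOF: with `P = {pairs meeting L₀}` the class is determined by `ω ∩ P` (`Consts.markerOff_eq_iff_inter`); on the class,
  `C_s(ω) = C_s(ω∖P) ∪ M(ω∩P)` (`Consts.openEdgeCluster_eq_of_markerOff`), `{s↮X}` and `{s↔z}` (`z ∉ L₀`) are read off `ω∖P`
  (`Consts.markerOff_reachable_iff_sdiff`, `…_mem_iff`); block independence of `ω∩P` and `ω∖P` (`BHK2006.blockFubini`) and "deleting the pairs of
  `P` = zeroing their weights" (`BHK2006.integral_comp_sdiff_prodBernoulli`) reduce the claim, block by block, to van den Berg–Häggström–Kahn's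
  Theorem 1.3 for the cluster of `s` in `G − L₀` repelled from `X` (`BHK2006_clusterConditionalPositiveAssociation_holds`) with the increasing
  functionals `K ↦ F(K ∪ M)` and `1{z ∈ V(K)}`; the `{s↔z}`-side does not depend on the block, so the blocks add up without cross terms.
  Summed over the classes this is `MDLX(F) − J_y(F) = E_ν[Cov_ν(F, 1_Z | L, 1_Y)] ≥ 0`, i.e. **`Consts.MDLXJoint` ⟸ J_y** (memo §8; the summation
  is left to the file that types J_y).
[cite: VandenbergHaggstromKahn2005, Thm. 1.3 (p. 6), §1 pp. 7–8, §2.1 Lemma 2.3 (p. 10)]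
-/

noncomputable section

namespace Summit.CriticalPhenomena.PercolationContinuityZ3.Theorems

open MeasureTheory Set Literature.Probability.LatticeModels Literature.Probability.Percolation
open scoped Classical

namespace Consts

variable {V : Type*} [Fintype V]

open Literature.Probability.Percolation.BHK2006 in
/-- **Within a marker class, `F(C_s)` and `{s ↔ z}` are positively correlated (given `s ↮ X`).**  For all weights, `s ≠ y`, `z`, `X`, every
monotone `F`, every vertex set `L₀` and truth value `a`, with `cls = {ω | L(ω) = L₀ ∧ ((∃ u ∈ L₀, s(s,u) ∈ ω) ↔ a)}`:
`(∫_{D∩cls} F(C_s)) · μ(D ∩ cls ∩ {s↔z}) ≤ μ(D ∩ cls) · ∫_{D∩cls∩{s↔z}} F(C_s)`.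
[cite: VandenbergHaggstromKahn2005, Thm. 1.3 (p. 6), §1 pp. 7–8, §2.1 Lemma 2.3 (p. 10)] -/
theorem markerClass_condCov_nonneg (w : Sym2 V → unitInterval) (s y z : V) (X : Set V) (hsy : s ≠ y)
    (F : Set (Sym2 V) → ℝ) (hF : Monotone F) (L₀ : Set V) (a : Prop) :
    (∫ ω in {ω : BondConfig V | ∀ x ∈ X, ¬ (openGraph ω).Reachable s x} ∩
        {ω | {v : V | (openGraph (ω \ {e : Sym2 V | s ∈ e})).Reachable y v} = L₀ ∧ ((∃ u ∈ L₀, s(s, u) ∈ ω) ↔ a)},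
        F (openEdgeCluster ω s) ∂(prodBernoulli w)) *
      (prodBernoulli w).real ({ω : BondConfig V | ∀ x ∈ X, ¬ (openGraph ω).Reachable s x} ∩
        {ω | {v : V | (openGraph (ω \ {e : Sym2 V | s ∈ e})).Reachable y v} = L₀ ∧ ((∃ u ∈ L₀, s(s, u) ∈ ω) ↔ a)} ∩ openConn s z) ≤
    (prodBernoulli w).real ({ω : BondConfig V | ∀ x ∈ X, ¬ (openGraph ω).Reachable s x} ∩
        {ω | {v : V | (openGraph (ω \ {e : Sym2 V | s ∈ e})).Reachable y v} = L₀ ∧ ((∃ u ∈ L₀, s(s, u) ∈ ω) ↔ a)}) *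
      ∫ ω in {ω : BondConfig V | ∀ x ∈ X, ¬ (openGraph ω).Reachable s x} ∩
        {ω | {v : V | (openGraph (ω \ {e : Sym2 V | s ∈ e})).Reachable y v} = L₀ ∧ ((∃ u ∈ L₀, s(s, u) ∈ ω) ↔ a)} ∩ openConn s z,
        F (openEdgeCluster ω s) ∂(prodBernoulli w) := by
  classical
  set μ := prodBernoulli w with hμ
  have hmeas : ∀ S : Set (BondConfig V), MeasurableSet S := fun _ => MeasurableSet.of_discrete
  set D : Set (BondConfig V) := {ω | ∀ x ∈ X, ¬ (openGraph ω).Reachable s x} with hD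
  set cls : Set (BondConfig V) :=
    {ω | {v : V | (openGraph (ω \ {e : Sym2 V | s ∈ e})).Reachable y v} = L₀ ∧ ((∃ u ∈ L₀, s(s, u) ∈ ω) ↔ a)} with hcls
  set Zv : Set (BondConfig V) := openConn s z with hZv
  set f : BondConfig V → ℝ := fun ω => F (openEdgeCluster ω s) with hf
  change (∫ ω in D ∩ cls, f ω ∂μ) * μ.real (D ∩ cls ∩ Zv) ≤ μ.real (D ∩ cls) * ∫ ω in D ∩ cls ∩ Zv, f ω ∂μ
  -- nonnegativity basics
  have hf_int : ∀ S, IntegrableOn f S μ := fun S => (Integrable.of_finite).integrableOn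
  -- Case `s ∈ X`: `D = ∅`.
  by_cases hsX : s ∈ X
  · have hDe : D = ∅ := eq_empty_of_forall_notMem fun ω hω => hω s hsX (SimpleGraph.Reachable.refl s)
    simp [hDe]
  -- Case `a ∧ X ∩ L₀ ≠ ∅`: `D ∩ cls = ∅`.
  by_cases hbad : a ∧ ∃ x ∈ X, x ∈ L₀
  · obtain ⟨ha, x, hxX, hxL⟩ := hbad
    have hDc : D ∩ cls = ∅ := by
      refine eq_empty_of_forall_notMem fun ω hω => ?_
      obtain ⟨hωD, hL, hA⟩ := hω
      have hxL' : x ∈ {v : V | (openGraph (ω \ {e : Sym2 V | s ∈ e})).Reachable y v} := by rw [hL]; exact hxL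
      have hAev : ∃ u ∈ {v : V | (openGraph (ω \ {e : Sym2 V | s ∈ e})).Reachable y v}, s(s, u) ∈ ω := by
        rw [hL]; exact hA.2 ha
      exact hωD x hxX ((markerOff_reachable_mem_iff hsy ω hxL').2 hAev)
    rw [hDc, empty_inter]; simp
  -- Case `z ∈ L₀`: `{s↔z}` is constant on the class.
  by_cases hzL : z ∈ L₀
  · by_cases ha : a
    · -- then `D ∩ cls ⊆ Zv`
      have hsub : D ∩ cls ∩ Zv = D ∩ cls := by
        refine inter_eq_left.2 fun ω hω => ?_
        obtain ⟨-, hL, hA⟩ := hω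
        have hzL' : z ∈ {v : V | (openGraph (ω \ {e : Sym2 V | s ∈ e})).Reachable y v} := by rw [hL]; exact hzL
        have hAev : ∃ u ∈ {v : V | (openGraph (ω \ {e : Sym2 V | s ∈ e})).Reachable y v}, s(s, u) ∈ ω := by
          rw [hL]; exact hA.2 ha
        exact (markerOff_reachable_mem_iff hsy ω hzL').2 hAev
      rw [hsub, mul_comm]
    · have hemp : D ∩ cls ∩ Zv = ∅ := by
        refine eq_empty_of_forall_notMem fun ω hω => ?_
        obtain ⟨⟨-, hL, hA⟩, hZ⟩ := hω
        have hzL' : z ∈ {v : V | (openGraph (ω \ {e : Sym2 V | s ∈ e})).Reachable y v} := by rw [hL]; exact hzL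
        have hAev := (markerOff_reachable_mem_iff hsy ω hzL').1 hZ
        rw [hL] at hAev
        exact ha (hA.1 hAev)
      rw [hemp]; simp
  -- Main case: `z ∉ L₀`, and (`¬a` or `X ∩ L₀ = ∅`).
  set P : Set (Sym2 V) := {e : Sym2 V | ∃ v ∈ e, v ∈ L₀} with hP
  set w' : Sym2 V → ℝ := fun e => (w e : ℝ) with hw'
  have hw0 : ∀ e, 0 ≤ w' e := fun e => (w e).2.1
  have hw1 : ∀ e, w' e ≤ 1 := fun e => (w e).2.2
  have hm : ∑ ω, weight w' ω = 1 := by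
    have h1 := integral_prodBernoulli_eq_sum w fun _ => (1 : ℝ)
    simp only [integral_const, probReal_univ, smul_eq_mul, mul_one] at h1
    exact h1.symm
  -- block functions
  set G : Set (Sym2 V) → ℝ := fun ζ => if ζ ∈ cls then 1 else 0 with hG
  set M : Set (Sym2 V) → Set (Sym2 V) := fun ζ =>
    {e | (∃ u ∈ L₀, s(s, u) ∈ ζ) ∧ e ∈ ζ ∧ (∃ v ∈ e, v ∈ L₀) ∧ ¬ e.IsDiag ∧ ∀ v ∈ e, v ∈ L₀ ∨ v = s} with hM
  set D' : Set (BondConfig V) := {η | ∀ x ∈ X, ¬ (openGraph η).Reachable s x} with hD'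
  set Fz : Set (Sym2 V) → Set (Sym2 V) → ℝ := fun ζ K => F (K ∪ M ζ) with hFz
  have hFz_mono : ∀ ζ, Monotone (Fz ζ) := fun ζ K K' hKK' => hF (union_subset_union_left _ hKK')
  -- (i) the class is determined by `ω ∩ P`
  have hGcls : ∀ ω : BondConfig V, ω ∈ cls ↔ ω ∩ P ∈ cls := by
    intro ω
    have hpair : ∀ u ∈ L₀, (s(s, u) ∈ ω ↔ s(s, u) ∈ ω ∩ P) := fun u hu =>
      ⟨fun h => ⟨h, u, Sym2.mem_mk_right s u, hu⟩, fun h => h.1⟩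
    have hex : (∃ u ∈ L₀, s(s, u) ∈ ω) ↔ ∃ u ∈ L₀, s(s, u) ∈ ω ∩ P :=
      ⟨fun ⟨u, hu, h⟩ => ⟨u, hu, (hpair u hu).1 h⟩, fun ⟨u, hu, h⟩ => ⟨u, hu, (hpair u hu).2 h⟩⟩
    simp only [hcls, mem_setOf_eq]
    rw [markerOff_eq_iff_inter ω L₀, hex]
  -- (ii) on the class: `D`, `Zv`, `f` read off `ω ∖ P` and `M(ω ∩ P)`
  have hreadD : ∀ ω ∈ cls, (ω ∈ D ↔ ω \ P ∈ D') := by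
    intro ω hω
    obtain ⟨hL, hA⟩ := hω
    constructor
    · intro hωD x hx hr
      exact hωD x hx (hr.mono (openGraph_mono sdiff_subset))
    · intro hD2 x hx hr
      by_cases hxL : x ∈ L₀
      · -- then `a` holds, contradicting `hbad`
        have hxL' : x ∈ {v : V | (openGraph (ω \ {e : Sym2 V | s ∈ e})).Reachable y v} := by rw [hL]; exact hxL
        have hAev := (markerOff_reachable_mem_iff hsy ω hxL').1 hr
        rw [hL] at hAev
        exact hbad ⟨hA.1 hAev, x, hx, hxL⟩
      · have hxL' : x ∉ {v : V | (openGraph (ω \ {e : Sym2 V | s ∈ e})).Reachable y v} := by rw [hL]; exact hxL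
        have h := (markerOff_reachable_iff_sdiff hsy ω hxL').1 hr
        rw [hL] at h
        exact hD2 x hx h
  have hreadZ : ∀ ω ∈ cls, (ω ∈ Zv ↔ (openGraph (ω \ P)).Reachable s z) := by
    intro ω hω
    obtain ⟨hL, -⟩ := hω
    have hzL' : z ∉ {v : V | (openGraph (ω \ {e : Sym2 V | s ∈ e})).Reachable y v} := by rw [hL]; exact hzL
    have h := markerOff_reachable_iff_sdiff hsy ω hzL'
    rw [hL] at h
    exact h
  have hreadF : ∀ ω ∈ cls, f ω = Fz (ω ∩ P) (openEdgeCluster (ω \ P) s) := by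
    intro ω hω
    obtain ⟨hL, -⟩ := hω
    have h := openEdgeCluster_eq_of_markerOff hsy ω L₀ hL
    have hMeq : {e | (∃ u ∈ L₀, s(s, u) ∈ ω) ∧ e ∈ ω ∧ (∃ v ∈ e, v ∈ L₀) ∧ ¬ e.IsDiag ∧ ∀ v ∈ e, v ∈ L₀ ∨ v = s} = M (ω ∩ P) := by
      ext e
      simp only [hM, mem_setOf_eq, mem_inter_iff]
      constructor
      · rintro ⟨⟨u, hu, hsu⟩, heω, hv, hd, hall⟩
        exact ⟨⟨u, hu, hsu, u, Sym2.mem_mk_right s u, hu⟩, ⟨heω, hv⟩, hv, hd, hall⟩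
      · rintro ⟨⟨u, hu, hsu, -⟩, ⟨heω, -⟩, hv, hd, hall⟩
        exact ⟨⟨u, hu, hsu⟩, heω, hv, hd, hall⟩
    show F (openEdgeCluster ω s) = F (openEdgeCluster (ω \ P) s ∪ M (ω ∩ P))
    rw [h, hMeq]
  -- (iii) the four quantities as block sums `Σ_ω weight(ω) · G(ω∩P) · Ψ(ω∩P, ω∖P)`
  set Ψ1 : Set (Sym2 V) → Set (Sym2 V) → ℝ := fun ζ η => (if η ∈ D' then 1 else 0) * Fz ζ (openEdgeCluster η s) with hΨ1
  set Ψ2 : Set (Sym2 V) → Set (Sym2 V) → ℝ := fun _ η => if η ∈ D' ∧ (openGraph η).Reachable s z then 1 else 0 with hΨ2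
  set Ψ3 : Set (Sym2 V) → Set (Sym2 V) → ℝ := fun _ η => if η ∈ D' then 1 else 0 with hΨ3
  set Ψ4 : Set (Sym2 V) → Set (Sym2 V) → ℝ := fun ζ η =>
    (if η ∈ D' ∧ (openGraph η).Reachable s z then 1 else 0) * Fz ζ (openEdgeCluster η s) with hΨ4
  have hsum : ∀ (S : Set (BondConfig V)) (g : BondConfig V → ℝ),
      ∫ ω in S, g ω ∂μ = ∑ ω, weight w' ω * S.indicator g ω := by
    intro S g
    rw [← integral_indicator (hmeas S), integral_prodBernoulli_eq_sum]
  have hreal : ∀ S : Set (BondConfig V), μ.real S = ∑ ω, weight w' ω * S.indicator 1 ω := by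
    intro S
    rw [← integral_indicator_one (hmeas S), integral_prodBernoulli_eq_sum]
  -- pointwise block forms
  have hpt1 : ∀ ω, (D ∩ cls).indicator f ω = G (ω ∩ P) * Ψ1 (ω ∩ P) (ω \ P) := by
    intro ω
    by_cases hc : ω ∈ cls
    · have hG1 : G (ω ∩ P) = 1 := by simp only [hG, if_pos ((hGcls ω).1 hc)]
      by_cases hd : ω ∈ D
      · rw [indicator_of_mem (show ω ∈ D ∩ cls from ⟨hd, hc⟩), hG1, one_mul, hΨ1]
        simp only [if_pos ((hreadD ω hc).1 hd), one_mul]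
        exact hreadF ω hc
      · rw [indicator_of_notMem (fun h => hd h.1), hG1, one_mul, hΨ1]
        simp only [if_neg (fun h => hd ((hreadD ω hc).2 h)), zero_mul]
    · have hG0 : G (ω ∩ P) = 0 := by simp only [hG, if_neg (fun h => hc ((hGcls ω).2 h))]
      rw [indicator_of_notMem (fun h => hc h.2), hG0, zero_mul]
  have hpt4 : ∀ ω, (D ∩ cls ∩ Zv).indicator f ω = G (ω ∩ P) * Ψ4 (ω ∩ P) (ω \ P) := by
    intro ω
    by_cases hc : ω ∈ cls
    · have hG1 : G (ω ∩ P) = 1 := by simp only [hG, if_pos ((hGcls ω).1 hc)]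
      by_cases hd : ω ∈ D ∩ cls ∩ Zv
      · rw [indicator_of_mem hd, hG1, one_mul, hΨ4]
        simp only [if_pos (And.intro ((hreadD ω hc).1 hd.1.1) ((hreadZ ω hc).1 hd.2)), one_mul]
        exact hreadF ω hc
      · rw [indicator_of_notMem hd, hG1, one_mul, hΨ4]
        have : ¬ (ω \ P ∈ D' ∧ (openGraph (ω \ P)).Reachable s z) := fun h =>
          hd ⟨⟨(hreadD ω hc).2 h.1, hc⟩, (hreadZ ω hc).2 h.2⟩
        simp only [if_neg this, zero_mul]
    · have hG0 : G (ω ∩ P) = 0 := by simp only [hG, if_neg (fun h => hc ((hGcls ω).2 h))]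
      rw [indicator_of_notMem (fun h => hc h.1.2), hG0, zero_mul]
  have hpt3 : ∀ ω, (D ∩ cls).indicator (1 : BondConfig V → ℝ) ω = G (ω ∩ P) * Ψ3 (ω ∩ P) (ω \ P) := by
    intro ω
    by_cases hc : ω ∈ cls
    · have hG1 : G (ω ∩ P) = 1 := by simp only [hG, if_pos ((hGcls ω).1 hc)]
      by_cases hd : ω ∈ D
      · rw [indicator_of_mem (show ω ∈ D ∩ cls from ⟨hd, hc⟩), hG1, one_mul, hΨ3, Pi.one_apply]; simp only [if_pos ((hreadD ω hc).1 hd)]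
      · rw [indicator_of_notMem (fun h => hd h.1), hG1, one_mul, hΨ3]; simp only [if_neg (fun h => hd ((hreadD ω hc).2 h))]
    · have hG0 : G (ω ∩ P) = 0 := by simp only [hG, if_neg (fun h => hc ((hGcls ω).2 h))]
      rw [indicator_of_notMem (fun h => hc h.2), hG0, zero_mul]
  have hpt2 : ∀ ω, (D ∩ cls ∩ Zv).indicator (1 : BondConfig V → ℝ) ω = G (ω ∩ P) * Ψ2 (ω ∩ P) (ω \ P) := by
    intro ω
    by_cases hc : ω ∈ cls
    · have hG1 : G (ω ∩ P) = 1 := by simp only [hG, if_pos ((hGcls ω).1 hc)]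
      by_cases hd : ω ∈ D ∩ cls ∩ Zv
      · rw [indicator_of_mem hd, hG1, one_mul, hΨ2, Pi.one_apply]
        simp only [if_pos (And.intro ((hreadD ω hc).1 hd.1.1) ((hreadZ ω hc).1 hd.2))]
      · rw [indicator_of_notMem hd, hG1, one_mul, hΨ2]
        have : ¬ (ω \ P ∈ D' ∧ (openGraph (ω \ P)).Reachable s z) := fun h =>
          hd ⟨⟨(hreadD ω hc).2 h.1, hc⟩, (hreadZ ω hc).2 h.2⟩
        simp only [if_neg this]
    · have hG0 : G (ω ∩ P) = 0 := by simp only [hG, if_neg (fun h => hc ((hGcls ω).2 h))]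
      rw [indicator_of_notMem (fun h => hc h.1.2), hG0, zero_mul]
  -- block independence: `Σ_ω wt Φ(ω∩P, ω∖P) = Σ_ω wt · Σ_ω' wt Φ(ω∩P, ω'∖P)`
  have hblock : ∀ Ψ : Set (Sym2 V) → Set (Sym2 V) → ℝ,
      ∑ ω, weight w' ω * (G (ω ∩ P) * Ψ (ω ∩ P) (ω \ P)) =
        ∑ ω, weight w' ω * (G (ω ∩ P) * ∑ ω', weight w' ω' * Ψ (ω ∩ P) (ω' \ P)) := by
    intro Ψ
    have h := blockFubini w' P (fun ζ η => G ζ * Ψ ζ η)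
    rw [hm, one_mul] at h
    rw [h]
    refine Finset.sum_congr rfl fun ω _ => ?_
    rw [Finset.mul_sum]
    simp_rw [← mul_assoc]
    rw [Finset.mul_sum]
    refine Finset.sum_congr rfl fun ω' _ => ?_
    ring
  -- inner sums as integrals under the pinned weights (pairs of `P` closed)
  set J1 : Set (Sym2 V) → ℝ := fun ζ => ∫ η in D', Fz ζ (openEdgeCluster η s) ∂(prodBernoulli fun i : Sym2 V => if i ∈ P then 0 else w i) with hJ1
  set J4 : Set (Sym2 V) → ℝ := fun ζ => ∫ η in D' ∩ openConn s z, Fz ζ (openEdgeCluster η s) ∂(prodBernoulli fun i : Sym2 V => if i ∈ P then 0 else w i) with hJ4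
  set J2 : ℝ := (prodBernoulli fun i : Sym2 V => if i ∈ P then 0 else w i).real (D' ∩ openConn s z) with hJ2
  set J3 : ℝ := (prodBernoulli fun i : Sym2 V => if i ∈ P then 0 else w i).real D' with hJ3
  have hinner1 : ∀ ζ, ∑ ω', weight w' ω' * Ψ1 ζ (ω' \ P) = J1 ζ := by
    intro ζ
    simp only [hJ1]
    rw [← integral_prodBernoulli_eq_sum w (fun ω' => Ψ1 ζ (ω' \ P)), BHK2006.integral_comp_sdiff_prodBernoulli w P (Ψ1 ζ)]
    have hfun : Ψ1 ζ = D'.indicator (fun η => Fz ζ (openEdgeCluster η s)) := by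
      funext η
      by_cases hη : η ∈ D'
      · simp only [hΨ1, if_pos hη, one_mul, indicator_of_mem hη]
      · simp only [hΨ1, if_neg hη, zero_mul, indicator_of_notMem hη]
    rw [hfun, integral_indicator (hmeas D')]
    congr
    funext i
    split_ifs <;> rfl
  have hinner4 : ∀ ζ, ∑ ω', weight w' ω' * Ψ4 ζ (ω' \ P) = J4 ζ := by
    intro ζ
    simp only [hJ4]
    rw [← integral_prodBernoulli_eq_sum w (fun ω' => Ψ4 ζ (ω' \ P)), BHK2006.integral_comp_sdiff_prodBernoulli w P (Ψ4 ζ)]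
    have hfun : Ψ4 ζ = (D' ∩ openConn s z).indicator (fun η => Fz ζ (openEdgeCluster η s)) := by
      funext η
      by_cases hη : η ∈ D' ∩ openConn s z
      · simp only [hΨ4, if_pos (show η ∈ D' ∧ (openGraph η).Reachable s z from hη), one_mul, indicator_of_mem hη]
      · simp only [hΨ4, if_neg (show ¬ (η ∈ D' ∧ (openGraph η).Reachable s z) from hη), zero_mul, indicator_of_notMem hη]
    rw [hfun, integral_indicator (hmeas _)]
    congr
    funext i
    split_ifs <;> rfl
  have hinner2 : ∀ ζ, ∑ ω', weight w' ω' * Ψ2 ζ (ω' \ P) = J2 := by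
    intro ζ
    simp only [hJ2]
    rw [← integral_prodBernoulli_eq_sum w (fun ω' => Ψ2 ζ (ω' \ P)), BHK2006.integral_comp_sdiff_prodBernoulli w P (Ψ2 ζ)]
    have hfun : Ψ2 ζ = (D' ∩ openConn s z).indicator (1 : BondConfig V → ℝ) := by
      funext η
      by_cases hη : η ∈ D' ∩ openConn s z
      · simp only [hΨ2, if_pos (show η ∈ D' ∧ (openGraph η).Reachable s z from hη), indicator_of_mem hη, Pi.one_apply]
      · simp only [hΨ2, if_neg (show ¬ (η ∈ D' ∧ (openGraph η).Reachable s z) from hη), indicator_of_notMem hη]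
    rw [hfun, integral_indicator_one (hmeas _)]
    congr
    funext i
    split_ifs <;> rfl
  have hinner3 : ∀ ζ, ∑ ω', weight w' ω' * Ψ3 ζ (ω' \ P) = J3 := by
    intro ζ
    simp only [hJ3]
    rw [← integral_prodBernoulli_eq_sum w (fun ω' => Ψ3 ζ (ω' \ P)), BHK2006.integral_comp_sdiff_prodBernoulli w P (Ψ3 ζ)]
    have hfun : Ψ3 ζ = D'.indicator (1 : BondConfig V → ℝ) := by
      funext η
      by_cases hη : η ∈ D'
      · simp only [hΨ3, if_pos hη, indicator_of_mem hη, Pi.one_apply]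
      · simp only [hΨ3, if_neg hη, indicator_of_notMem hη]
    rw [hfun, integral_indicator_one (hmeas _)]
    congr
    funext i
    split_ifs <;> rfl
  -- (iv) BHK Theorem 1.3 in `G − L₀`, block by block: `J1 ζ · J2 ≤ J3 · J4 ζ`
  have hBHK : ∀ ζ, J1 ζ * J2 ≤ J3 * J4 ζ := by
    intro ζ
    have key := BHK2006_clusterConditionalPositiveAssociation_holds V (fun i : Sym2 V => if i ∈ P then 0 else w i) s X (Fz ζ)
      (connIndicatorFn s z) (hFz_mono ζ) (monotone_connIndicatorFn s z) hsX
    have h1 : ∫ η in D', connIndicatorFn s z (openEdgeCluster η s) ∂(prodBernoulli fun i : Sym2 V => if i ∈ P then 0 else w i) = (prodBernoulli fun i : Sym2 V => if i ∈ P then 0 else w i).real (D' ∩ openConn s z) := by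
      simp_rw [connIndicatorFn_openEdgeCluster]
      exact KNPreFKG.setIntegral_indicator_one_eq (prodBernoulli fun i : Sym2 V => if i ∈ P then 0 else w i) D' _
    have h2 : ∫ η in D', Fz ζ (openEdgeCluster η s) * connIndicatorFn s z (openEdgeCluster η s) ∂(prodBernoulli fun i : Sym2 V => if i ∈ P then 0 else w i) =
        ∫ η in D' ∩ openConn s z, Fz ζ (openEdgeCluster η s) ∂(prodBernoulli fun i : Sym2 V => if i ∈ P then 0 else w i) := by
      simp_rw [connIndicatorFn_openEdgeCluster]
      have hfun : (fun η : BondConfig V => Fz ζ (openEdgeCluster η s) * (openConn s z : Set (BondConfig V)).indicator 1 η) =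
          (openConn s z : Set (BondConfig V)).indicator (fun η => Fz ζ (openEdgeCluster η s)) := by
        funext η
        rw [← Set.indicator_mul_right (openConn s z) (fun η => Fz ζ (openEdgeCluster η s)) (1 : BondConfig V → ℝ)]
        simp only [Pi.one_apply, mul_one]
      rw [hfun, setIntegral_indicator (hmeas _)]
    simp only [hJ1, hJ2, hJ3, hJ4]
    rw [← h1, ← h2]
    exact key
  -- (v) assemble
  have hq1 : ∫ ω in D ∩ cls, f ω ∂μ = ∑ ω, weight w' ω * (G (ω ∩ P) * J1 (ω ∩ P)) := by
    rw [hsum, show (fun ω => weight w' ω * (D ∩ cls).indicator f ω) = fun ω => weight w' ω * (G (ω ∩ P) * Ψ1 (ω ∩ P) (ω \ P))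
      from funext fun ω => by rw [hpt1], hblock Ψ1]
    simp_rw [hinner1]
  have hq4 : ∫ ω in D ∩ cls ∩ Zv, f ω ∂μ = ∑ ω, weight w' ω * (G (ω ∩ P) * J4 (ω ∩ P)) := by
    rw [hsum, show (fun ω => weight w' ω * (D ∩ cls ∩ Zv).indicator f ω) = fun ω => weight w' ω * (G (ω ∩ P) * Ψ4 (ω ∩ P) (ω \ P))
      from funext fun ω => by rw [hpt4], hblock Ψ4]
    simp_rw [hinner4]
  have hq3 : μ.real (D ∩ cls) = ∑ ω, weight w' ω * (G (ω ∩ P) * J3) := by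
    rw [hreal, show (fun ω => weight w' ω * (D ∩ cls).indicator (1 : BondConfig V → ℝ) ω) =
      fun ω => weight w' ω * (G (ω ∩ P) * Ψ3 (ω ∩ P) (ω \ P)) from funext fun ω => by rw [hpt3], hblock Ψ3]
    simp_rw [hinner3]
  have hq2 : μ.real (D ∩ cls ∩ Zv) = ∑ ω, weight w' ω * (G (ω ∩ P) * J2) := by
    rw [hreal, show (fun ω => weight w' ω * (D ∩ cls ∩ Zv).indicator (1 : BondConfig V → ℝ) ω) =
      fun ω => weight w' ω * (G (ω ∩ P) * Ψ2 (ω ∩ P) (ω \ P)) from funext fun ω => by rw [hpt2], hblock Ψ2]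
    simp_rw [hinner2]
  rw [hq1, hq2, hq3, hq4]
  -- `Σ wt G J2 = J2 Σ wt G`, `Σ wt G J3 = J3 Σ wt G`
  have hG0 : ∀ ζ, 0 ≤ G ζ := fun ζ => by simp only [hG]; split_ifs <;> norm_num
  have hwt0 : ∀ ω, 0 ≤ weight w' ω := fun ω => weight_nonneg hw0 hw1 ω
  set qG := ∑ ω, weight w' ω * G (ω ∩ P) with hqG
  have hqG0 : 0 ≤ qG := Finset.sum_nonneg fun ω _ => mul_nonneg (hwt0 ω) (hG0 _)
  have e2 : ∑ ω, weight w' ω * (G (ω ∩ P) * J2) = J2 * qG := by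
    rw [hqG, Finset.mul_sum]; refine Finset.sum_congr rfl fun ω _ => ?_; ring
  have e3 : ∑ ω, weight w' ω * (G (ω ∩ P) * J3) = J3 * qG := by
    rw [hqG, Finset.mul_sum]; refine Finset.sum_congr rfl fun ω _ => ?_; ring
  rw [e2, e3]
  -- termwise: `wt G (J1 J2) ≤ wt G (J3 J4)`
  have hterm : J2 * ∑ ω, weight w' ω * (G (ω ∩ P) * J1 (ω ∩ P)) ≤ J3 * ∑ ω, weight w' ω * (G (ω ∩ P) * J4 (ω ∩ P)) := by
    rw [Finset.mul_sum, Finset.mul_sum]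
    refine Finset.sum_le_sum fun ω _ => ?_
    have h := mul_le_mul_of_nonneg_left (hBHK (ω ∩ P)) (mul_nonneg (hwt0 ω) (hG0 (ω ∩ P)))
    nlinarith [h]
  calc (∑ ω, weight w' ω * (G (ω ∩ P) * J1 (ω ∩ P))) * (J2 * qG)
      = qG * (J2 * ∑ ω, weight w' ω * (G (ω ∩ P) * J1 (ω ∩ P))) := by ring
    _ ≤ qG * (J3 * ∑ ω, weight w' ω * (G (ω ∩ P) * J4 (ω ∩ P))) := mul_le_mul_of_nonneg_left hterm hqG0
    _ = J3 * qG * ∑ ω, weight w' ω * (G (ω ∩ P) * J4 (ω ∩ P)) := by ring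

end Consts

end Summit.CriticalPhenomena.PercolationContinuityZ3.Theorems

end
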